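import Mathlib
import Literature.Analysis.FluidPDE.PassiveScalar
import Literature.Analysis.FluidPDE.EnergyToolkit
import HarnessLib

/-!
# Negative knowledge for the crux `FloorUpgrade` (stmt-AnomalousDissipation-15010), 0: tools for the
# transport speed limit

Route `route-AnomalousDissipation-LimitingAbsorption`, crux r4
`Summit.AnomalousDissipation.AnomalousDissipation.Theses.LimitingAbsorption.FloorUpgrade`; supports
stmt-AnomalousDissipation-15010 (refuter / crux-disprover lane). Elementary lemmas used by
`Theorems/FloorUpgrade/Negative/FastClassEmpty.lean` (the FAST relaxing-family class of line
`SketchIdeator1` is empty): positivity of `‖h‖²₂` for a smooth `h ≠ 0`, the numerical inequality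
`y⁶ e^{-6y} ≤ 1/64` (`y ≥ 1`), the pointwise sweeping bound `‖w·∇h‖₂ ≤ G‖w‖₂` for a gradient bound
`‖∇h‖ ≤ G`, and Cauchy–Schwarz in time `(∫₀^S √F)² ≤ S ∫₀^S F`.

## References

* T. D. Drivas, T. M. Elgindi, G. Iyer, I.-J. Jeong, ARMA 243 (2022), (1.2)–(1.3) (scalar balance,
  the `L²` currency `scalarL2Sq`). [`DEIJ2022`]
-/

noncomputable section

open MeasureTheory Set Filter Function TopologicalSpace Topology
open scoped ENNReal NNReal InnerProductSpace

namespace Summit.AnomalousDissipation.AnomalousDissipation.Theorems.FloorUpgrade.Negative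

-- D-0017: single-problem summit ⇒ `Summit.AnomalousDissipation.AnomalousDissipation.…` by design.
set_option linter.dupNamespace false

open Literature.Analysis Literature.Analysis.FluidPDE Literature.Analysis.FluidPDE.Torus

/-! ## Elementary lemmas -/

/-- A smooth profile `h ≠ 0` has `‖h‖²_{L²} > 0`. [folklore] -/
theorem scalarL2Sq_pos_of_ne_zero {h : UnitAddTorus (Fin 2) → ℝ} (hh : FunctionSpaces.Torus.IsSmooth h) (hh0 : h ≠ 0) :
    0 < scalarL2Sq h := by
  unfold scalarL2Sq
  rw [integral_pos_iff_support_of_nonneg (fun x => sq_nonneg (h x)) (hh.memLp 2).integrable_sq]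
  have hsupp : Function.support (fun x => h x ^ 2) = Function.support h := by
    ext x; simp
  rw [hsupp]
  obtain ⟨x, hx⟩ : ∃ x, h x ≠ 0 := Function.ne_iff.1 hh0
  exact (isOpen_ne_fun hh.continuous continuous_const).measure_pos volume ⟨x, hx⟩

/-- The numerical heart: `y⁶ e^{-6y} ≤ 1/64` for `y ≥ 1` (`y ≤ e^{y-1}`, `e ≥ 2`). [folklore] -/
theorem pow_six_mul_exp_le {y : ℝ} (hy : 1 ≤ y) : y ^ 6 * Real.exp (-(6 * y)) ≤ 1 / 64 := by
  have hy0 : 0 ≤ y := by linarith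
  have h1 : y ≤ Real.exp (y - 1) := by linarith [Real.add_one_le_exp (y - 1)]
  have h2 : y * Real.exp (-y) ≤ Real.exp (-1) := by
    calc y * Real.exp (-y) ≤ Real.exp (y - 1) * Real.exp (-y) := by
          gcongr
      _ = Real.exp (-1) := by rw [← Real.exp_add]; ring_nf
  have h3 : Real.exp (-1) ≤ 1 / 2 := by
    have he : (2 : ℝ) ≤ Real.exp 1 := by linarith [Real.add_one_le_exp (1 : ℝ)]
    rw [Real.exp_neg, one_div]
    exact inv_anti₀ (by norm_num) he
  have h4 : y ^ 6 * Real.exp (-(6 * y)) = (y * Real.exp (-y)) ^ 6 := by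
    rw [mul_pow, ← Real.exp_nat_mul]
    congr 1
    push_cast
    ring_nf
  rw [h4]
  have h5 : 0 ≤ y * Real.exp (-y) := mul_nonneg hy0 (Real.exp_pos _).le
  calc (y * Real.exp (-y)) ^ 6 ≤ (1 / 2) ^ 6 := pow_le_pow_left₀ h5 (h2.trans h3) 6
    _ = 1 / 64 := by norm_num

/-- Pointwise-in-time comparison `∫ ⟪w, ∇h⟫² ≤ G² ∫ ‖w‖²` for an `L²` slice `w` and a gradient
bound `‖∇h‖ ≤ G`. [folklore] -/
theorem integral_inner_gradient_sq_le {w : UnitAddTorus (Fin 2) → EuclideanSpace ℝ (Fin 2)} (hw : MemLp w 2 volume) {h : UnitAddTorus (Fin 2) → ℝ}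
    {G : ℝ} (hG : ∀ x, ‖FunctionSpaces.Torus.gradient h x‖ ≤ G) :
    ∫ x, (⟪w x, FunctionSpaces.Torus.gradient h x⟫_ℝ) ^ 2 ≤ G ^ 2 * ∫ x, ‖w x‖ ^ 2 := by
  rw [← integral_const_mul]
  have hint : Integrable (fun x => ‖w x‖ ^ 2) volume :=
    (memLp_two_iff_integrable_sq_norm hw.1).1 hw
  refine integral_mono_of_nonneg (Eventually.of_forall fun x => sq_nonneg _) (hint.const_mul _)
    (Eventually.of_forall fun x => ?_)
  have h1 : |⟪w x, FunctionSpaces.Torus.gradient h x⟫_ℝ| ≤ ‖w x‖ * G :=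
    (abs_real_inner_le_norm _ _).trans (mul_le_mul_of_nonneg_left (hG x) (norm_nonneg _))
  calc (⟪w x, FunctionSpaces.Torus.gradient h x⟫_ℝ) ^ 2
        = |⟪w x, FunctionSpaces.Torus.gradient h x⟫_ℝ| ^ 2 := (sq_abs _).symm
    _ ≤ (‖w x‖ * G) ^ 2 := pow_le_pow_left₀ (abs_nonneg _) h1 2
    _ = G ^ 2 * ‖w x‖ ^ 2 := by ring

/-- Square-root form of `integral_inner_gradient_sq_le`: `‖w·∇h‖₂ ≤ G ‖w‖₂`. [folklore] -/
theorem sqrt_integral_inner_gradient_sq_le {w : UnitAddTorus (Fin 2) → EuclideanSpace ℝ (Fin 2)} (hw : MemLp w 2 volume) {h : UnitAddTorus (Fin 2) → ℝ}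
    {G : ℝ} (hG : ∀ x, ‖FunctionSpaces.Torus.gradient h x‖ ≤ G) :
    Real.sqrt (∫ x, (⟪w x, FunctionSpaces.Torus.gradient h x⟫_ℝ) ^ 2) ≤
      G * Real.sqrt (∫ x, ‖w x‖ ^ 2) := by
  have hG0 : 0 ≤ G := (norm_nonneg _).trans (hG 0)
  calc Real.sqrt (∫ x, (⟪w x, FunctionSpaces.Torus.gradient h x⟫_ℝ) ^ 2)
        ≤ Real.sqrt (G ^ 2 * ∫ x, ‖w x‖ ^ 2) := Real.sqrt_le_sqrt (integral_inner_gradient_sq_le hw hG)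
    _ = G * Real.sqrt (∫ x, ‖w x‖ ^ 2) := by
        rw [Real.sqrt_mul (sq_nonneg G), Real.sqrt_sq hG0]

/-- Cauchy–Schwarz in time on `(0,S)`: `(∫₀^S √F)² ≤ S ∫₀^S F` for a continuous `F ≥ 0`. [folklore] -/
theorem sq_setIntegral_sqrt_le {F : ℝ → ℝ} {S : ℝ} (hS : 0 ≤ S) (hF : ContinuousOn F (Icc 0 S))
    (hF0 : ∀ t ∈ Icc 0 S, 0 ≤ F t) :
    (∫ τ in Ioo 0 S, Real.sqrt (F τ)) ^ 2 ≤ S * ∫ τ in Ioo 0 S, F τ := by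
  have hg : ContinuousOn (fun τ => Real.sqrt (F τ)) (Icc 0 S) :=
    Real.continuous_sqrt.comp_continuousOn hF
  obtain ⟨B, hB⟩ := isCompact_Icc.exists_bound_of_continuousOn hg
  haveI : IsFiniteMeasure ((volume : Measure ℝ).restrict (Ioo 0 S)) :=
    ⟨by rw [Measure.restrict_apply_univ, Real.volume_Ioo]; exact ENNReal.ofReal_lt_top⟩
  have hgm : AEStronglyMeasurable (fun τ => Real.sqrt (F τ)) (volume.restrict (Ioo 0 S)) :=
    (hg.mono Ioo_subset_Icc_self).aestronglyMeasurable measurableSet_Ioo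
  have hg2 : MemLp (fun τ => Real.sqrt (F τ)) 2 (volume.restrict (Ioo 0 S)) := by
    refine (memLp_top_of_bound hgm B ?_).mono_exponent le_top
    filter_upwards [ae_restrict_mem measurableSet_Ioo] with τ hτ
    exact hB τ (Ioo_subset_Icc_self hτ)
  have h1 : MemLp (fun _ : ℝ => (1 : ℝ)) 2 (volume.restrict (Ioo 0 S)) := memLp_const 1
  have hcs := integral_mul_le_sqrt_mul_sqrt_of_memLp h1 hg2
  have e1 : ∫ τ in Ioo 0 S, (1 : ℝ) * Real.sqrt (F τ) = ∫ τ in Ioo 0 S, Real.sqrt (F τ) := by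
    simp
  have e2 : ∫ _ in Ioo 0 S, (1 : ℝ) ^ 2 = S := by
    simp [hS]
  have e3 : ∫ τ in Ioo 0 S, (Real.sqrt (F τ)) ^ 2 = ∫ τ in Ioo 0 S, F τ := by
    refine integral_congr_ae ?_
    filter_upwards [ae_restrict_mem measurableSet_Ioo] with τ hτ
    exact Real.sq_sqrt (hF0 τ (Ioo_subset_Icc_self hτ))
  rw [e1, e2, e3] at hcs
  have h0 : 0 ≤ ∫ τ in Ioo 0 S, Real.sqrt (F τ) := integral_nonneg fun τ => Real.sqrt_nonneg _
  have hF0' : 0 ≤ ∫ τ in Ioo 0 S, F τ :=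
    setIntegral_nonneg measurableSet_Ioo fun τ hτ => hF0 τ (Ioo_subset_Icc_self hτ)
  calc (∫ τ in Ioo 0 S, Real.sqrt (F τ)) ^ 2
        ≤ (Real.sqrt S * Real.sqrt (∫ τ in Ioo 0 S, F τ)) ^ 2 := pow_le_pow_left₀ h0 hcs 2
    _ = S * ∫ τ in Ioo 0 S, F τ := by rw [mul_pow, Real.sq_sqrt hS, Real.sq_sqrt hF0']

end Summit.AnomalousDissipation.AnomalousDissipation.Theorems.FloorUpgrade.Negative

end
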